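import Mathlib
import HarnessLib
import Summits.ResolutionOfSingularities.ResolutionOfSingularities.Theorems.WildQuotientsWildQuotientResolutionS1aGraphTailPoint
import Summits.ResolutionOfSingularities.ResolutionOfSingularities.Theorems.WildQuotientsWildQuotientResolutionS1aQhSymAwayDatum
import Summits.ResolutionOfSingularities.ResolutionOfSingularities.Theorems.WildQuotientsWildQuotientResolutionS1aCuspRecentre

/-!
# S1a — R4c cusp LEVEL 1, THE TWO POINT ROOTS: at `O` (centre `(x₀ : 9, x₁ : 2, x₂ : 3)`, both tail generators moving) and at the far tangency point `Q`
(recentred, centre `(x₀ : 3, y : 1, v : 2)`, `v` invariant)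

[OURS · L1 W4.5c · lead-1 g17; plan-1 RULING R-F15v (2) ★ R4c `cusp_killsIn_two`, SPEC `Cruxes/CyclicQuotientFourfolds/Lines/s1a_logminvertex-R4c-SPEC.md` §1 (1O), (1Q):
pattern ✓`exists_graphTail_pointCentre` (R4e) — localise at the `σ`-fixed polynomial `hh = N(x₁ − α_other)` (✓`GraphTail.sigma_locPoly`, `α = (0, a)`), and produce
the node of `D(e⁻¹hh)` in the uniform trivial grading with its admissible point-type root by ✓`exists_pointCentre_away₀`; σ-adaptedness at `O` by the TWO-moving-generator
lemma ✓`QhSym.qs_poly_map_le` (`sh = 6`, tail `x₂² − x₁³ ∈ 𝒥₆` ✓`Cusp.cuspTail_mem`), at `Q` after the shear recentring ✓`FreeModel.exists_cusp_recentre` by the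
ONE-moving-generator lemma ✓`QhAway.qh_poly_map_le` (`sh = 2`, tail ✓`FreeModel.shear_cuspTail` `∈ 𝒥₂` ✓`Cusp.cuspTailQ_mem`)] — NOT statements of the manuscript;
counted 0; AI-level work, weaker than expert review. Crux stmt-ResolutionOfSingularities-17941 `CyclicQuotientFourfolds`, line `s1a-logminvertex` v13 (`stub_reachLowerInFX`).
-/

set_option linter.dupNamespace false

noncomputable section

open CategoryTheory Limits AlgebraicGeometry TopologicalSpace Topology Opposite MvPolynomial
open Literature.AlgebraicGeometry.Resolution Literature.AlgebraicGeometry.RelativeSpec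
open Summit.ResolutionOfSingularities.ResolutionOfSingularities.Theorems.WildQuotientResolution.S1
open Summit.ResolutionOfSingularities.ResolutionOfSingularities.Theorems.WildQuotientResolution.S1.NodeAtlas
open Summit.ResolutionOfSingularities.ResolutionOfSingularities.Theorems.WildQuotientResolution.S1.CoarseChart
open Summit.ResolutionOfSingularities.ResolutionOfSingularities.Theorems.WildQuotientResolution.S1.ProducerStep
open Summit.ResolutionOfSingularities.ResolutionOfSingularities.Theorems.WildQuotientResolution.S1.NpFrame
open Summit.ResolutionOfSingularities.ResolutionOfSingularities.Theorems.WildQuotientResolution.S1.GoodCharts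
open Summit.ResolutionOfSingularities.ResolutionOfSingularities.Theorems.WildQuotientResolution.S1.NodeAway
open Summit.ResolutionOfSingularities.ResolutionOfSingularities.Theorems.WildQuotientResolution.S1.NodeChartAway
open Summit.ResolutionOfSingularities.ResolutionOfSingularities.Theorems.WildQuotientResolution.S1.NodeTransport
open Summit.ResolutionOfSingularities.ResolutionOfSingularities.Theorems.WildQuotientResolution.S1.CentreAway
open Summit.ResolutionOfSingularities.ResolutionOfSingularities.Theorems.WildQuotientResolution.S1.BlowupCharts
open Summit.ResolutionOfSingularities.ResolutionOfSingularities.Theorems.WildQuotientResolution.S1.KillCert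

namespace Summit.ResolutionOfSingularities.ResolutionOfSingularities.Theorems.WildQuotientResolution.S1.GameFrame.GModel

variable {p : ℕ} {X' X₁ : Scheme.{0}} {q : X' ⟶ X₁} {G : Type} [Group G] {ρ : G →* Aut X'} {g₀ : G}

/-- `(0, a)` is injective for `a ≠ 0`. -/
theorem injective_zero_pair {k : Type} [Field k] {a : k} (ha : a ≠ 0) : Function.Injective (![(0 : k), a] : Fin 2 → k) := fun i j hij => by
  fin_cases i <;> fin_cases j
  · rfl
  · exact absurd (by simpa using hij : (0 : k) = a) (Ne.symm ha)
  · exact absurd (by simpa using hij : a = 0) ha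
  · rfl

set_option maxHeartbeats 4000000 in
/-- ★★ **R4c LEVEL 1 AT `O`**: the `σ`-fixed localising polynomial `hh_O = N(x₁ − a)`, the node of `D(e⁻¹hh_O)` in the uniform trivial grading, and its admissible root
`(x₀ : 9, x₁ : 2, x₂ : 3)` of Veronese degree `d > 0` with centre chart `D(e⁻¹hh_O)`, `G`-stability, filtration clause, `VeroneseNormalised`, support in the chart — for
the cusp datum `x₁ ↦ x₁ + x₀, x₂ ↦ x₂ + x₀, x₃ ↦ x₃ + (x₂² − x₁³)` (BOTH tail generators moving: ✓`QhSym.qs_poly_map_le`). [OURS · L1 W4.5c · R4c; NOT a statement of the manuscript] -/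
theorem exists_cuspO_pointCentre [Finite G] (hG : ∀ g : G, g ∈ Subgroup.zpowers g₀) (M : GModel p q G ρ g₀) [M.V.IsSeparated]
    (O : M.act.StableAffineOpens) (hO : IsAffineOpen O.1)
    {k : Type} [Field k] [Fact p.Prime] [CharP k p] (e : Γ(M.V, O.1) ≃+* (MvPolynomial (Fin 4) k)) (σ : (MvPolynomial (Fin 4) k) ≃+* (MvPolynomial (Fin 4) k)) (hC : ∀ a : k, σ (C a) = C a)
    (h0 : σ (X 0) = X 0) (h1 : σ (X 1) = X 1 + X 0) (h2 : σ (X 2) = X 2 + X 0) (h3 : σ (X 3) = X 3 + (X 2 ^ 2 - X 1 ^ 3))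
    (hact : ∀ t : Γ(M.V, O.1), actOEquiv M.act O g₀ t = e.symm (σ (e t))) (hσp : ∀ a : (MvPolynomial (Fin 4) k), (⇑σ)^[p] a = a)
    (hcl : ∀ S : Set Γ(M.V, O.1), IsClosed (M.V.zeroLocus (U := O.1) S ∩ (O.1 : Set M.V))) (a : k) (ha : a ≠ 0) :
    ∃ (hh : (MvPolynomial (Fin 4) k)) (_ : hh = (∏ j ∈ Finset.univ.erase (0 : Fin 2), ∏ l : ZMod p, (X 1 + C ((![(0 : k), a] : Fin 2 → k) 0 - (![(0 : k), a] : Fin 2 → k) j) + (l.val : MvPolynomial (Fin 4) k) * X 0))) (hσh : σ hh = hh)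
      (𝒜u : (Π j : Fin 0, ZMod ((![] : Fin 0 → ℕ) j)) → AddSubgroup (Localization.Away hh)) (_ : GradedRing 𝒜u) (eW : Γ(M.V, (basicOpenStable M.act O hO (actO_symm_eq_of_fixed hG M O e σ hact hh hσh)).1) ≃+* ↥(𝒜u 0)),
        (∀ (d : (Π j : Fin 0, ZMod ((![] : Fin 0 → ℕ) j))) (x : (Localization.Away hh)), x ∈ 𝒜u d) ∧
        IsTameNode p (Localization.Away hh) 𝒜u (sigmaAway σ hσh) ∧
        (∀ t' : Γ(M.V, (basicOpenStable M.act O hO (actO_symm_eq_of_fixed hG M O e σ hact hh hσh)).1), ((eW ((M.act.aut g₀⁻¹).hom.appLE (basicOpenStable M.act O hO (actO_symm_eq_of_fixed hG M O e σ hact hh hσh)).1 (basicOpenStable M.act O hO (actO_symm_eq_of_fixed hG M O e σ hact hh hσh)).1 ((basicOpenStable M.act O hO (actO_symm_eq_of_fixed hG M O e σ hact hh hσh)).2.1 g₀⁻¹).ge t') : ↥(𝒜u 0)) : (Localization.Away hh)) = sigmaAway σ hσh ((eW t' : ↥(𝒜u 0)) : (Localization.Away hh))) ∧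
        (∀ t : Γ(M.V, O.1), ((eW (algebraMap Γ(M.V, O.1) Γ(M.V, M.V.basicOpen (e.symm hh)) t) : ↥(𝒜u 0)) : (Localization.Away hh)) = algebraMap (MvPolynomial (Fin 4) k) (Localization.Away hh) (e t)) ∧
        ∃ (𝒦 : ReesFiltration M.V) (d : ℕ), 0 < d ∧ IsAdmissibleCentre p M.act g₀ 𝒦 d ∧ IsCentreChart p M.act g₀ 𝒦 d (basicOpenStable M.act O hO (actO_symm_eq_of_fixed hG M O e σ hact hh hσh)) ∧
          (∀ (g' : G) (n : ℕ), (𝒦.ideal n).comap (M.act.aut g').hom = 𝒦.ideal n) ∧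
          (∀ n, (𝒦.filtration ⟨(basicOpenStable M.act O hO (actO_symm_eq_of_fixed hG M O e σ hact hh hσh)).1, hO.basicOpen (e.symm hh)⟩).ideal n = ((traceFiltration 𝒜u (fun l => algebraMap (MvPolynomial (Fin 4) k) (Localization.Away hh) (X ((![0, 1, 2] : Fin 3 → Fin 4) l))) (![9, 2, 3] : Fin 3 → ℕ)).ideal n).comap (eW : Γ(M.V, (basicOpenStable M.act O hO (actO_symm_eq_of_fixed hG M O e σ hact hh hσh)).1) →+* ↥(𝒜u 0))) ∧
          VeroneseNormalised 𝒜u (fun l => algebraMap (MvPolynomial (Fin 4) k) (Localization.Away hh) (X ((![0, 1, 2] : Fin 3 → Fin 4) l))) (![9, 2, 3] : Fin 3 → ℕ) d ∧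
          (((𝒦.ideal d).support : Set M.V)) ⊆ ((basicOpenStable M.act O hO (actO_symm_eq_of_fixed hG M O e σ hact hh hσh)).1 : Set M.V) := by
  classical
  haveI : NeZero p := ⟨(Fact.out : p.Prime).ne_zero⟩
  have hα : Function.Injective (![(0 : k), a] : Fin 2 → k) := injective_zero_pair ha
  have hσh : σ (∏ j ∈ Finset.univ.erase (0 : Fin 2), ∏ l : ZMod p, (X 1 + C ((![(0 : k), a] : Fin 2 → k) 0 - (![(0 : k), a] : Fin 2 → k) j) + (l.val : MvPolynomial (Fin 4) k) * X 0)) = (∏ j ∈ Finset.univ.erase (0 : Fin 2), ∏ l : ZMod p, (X 1 + C ((![(0 : k), a] : Fin 2 → k) 0 - (![(0 : k), a] : Fin 2 → k) j) + (l.val : MvPolynomial (Fin 4) k) * X 0)) := GraphTail.sigma_locPoly σ hC h0 h1 (Finset.univ.erase 0) (fun j => (![(0 : k), a] : Fin 2 → k) 0 - (![(0 : k), a] : Fin 2 → k) j)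
  -- the hypotheses of the point-centre producer
  have hw1 : (![9, 2, 3] : Fin 3 → ℕ) 1 + 6 ≤ (![9, 2, 3] : Fin 3 → ℕ) 0 := by decide
  have hw2 : (![9, 2, 3] : Fin 3 → ℕ) 0 = (![9, 2, 3] : Fin 3 → ℕ) 2 + 6 := by decide
  have hσJ : ∀ n : ℕ, ((weightedFiltration ((X : Fin 4 → (MvPolynomial (Fin 4) k)) ∘ (![0, 1, 2] : Fin 3 → Fin 4)) (![9, 2, 3] : Fin 3 → ℕ)).ideal n).map (σ : (MvPolynomial (Fin 4) k) →+* (MvPolynomial (Fin 4) k)) ≤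
      (weightedFiltration ((X : Fin 4 → (MvPolynomial (Fin 4) k)) ∘ (![0, 1, 2] : Fin 3 → Fin 4)) (![9, 2, 3] : Fin 3 → ℕ)).ideal n :=
    fun n => QhSym.qs_poly_map_le σ hC h0 h1 h2 (X 2 ^ 2 - X 1 ^ 3) h3 (![9, 2, 3] : Fin 3 → ℕ) 6 hw1 hw2 Cusp.cuspTail_mem n
  have hne : ∀ j ∈ Finset.univ.erase (0 : Fin 2), (![(0 : k), a] : Fin 2 → k) 0 - (![(0 : k), a] : Fin 2 → k) j ≠ 0 := fun j hj h => Finset.ne_of_mem_erase hj (hα (sub_eq_zero.mp h)).symm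
  have hu : MvPolynomial.eval (fun _ : Fin 4 => (0 : k)) (∏ j ∈ Finset.univ.erase (0 : Fin 2), ∏ l : ZMod p, (X 1 + C ((![(0 : k), a] : Fin 2 → k) 0 - (![(0 : k), a] : Fin 2 → k) j) + (l.val : MvPolynomial (Fin 4) k) * X 0)) ≠ 0 := GraphTail.eval_locPoly_ne_zero (Finset.univ.erase 0) (fun j => (![(0 : k), a] : Fin 2 → k) 0 - (![(0 : k), a] : Fin 2 → k) j) hne _ rfl rfl
  have hcst : (∏ j ∈ Finset.univ.erase (0 : Fin 2), ((![(0 : k), a] : Fin 2 → k) 0 - (![(0 : k), a] : Fin 2 → k) j) ^ p) ≠ 0 := Finset.prod_ne_zero_iff.mpr fun j hj => pow_ne_zero _ (hne j hj)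
  have hZW := Scheme.zeroLocus_inter_subset_basicOpen_of_sub_C_mem_span (U := O.1) e (![0, 1, 2] : Fin 3 → Fin 4) (∏ j ∈ Finset.univ.erase (0 : Fin 2), ∏ l : ZMod p, (X 1 + C ((![(0 : k), a] : Fin 2 → k) 0 - (![(0 : k), a] : Fin 2 → k) j) + (l.val : MvPolynomial (Fin 4) k) * X 0)) _ hcst
    (GraphTail.locPoly_sub_C_mem_span (Finset.univ.erase 0) (fun j => (![(0 : k), a] : Fin 2 → k) 0 - (![(0 : k), a] : Fin 2 → k) j))
  obtain ⟨𝒜u, gr, eW, hfull, htame, hσW, hpin, 𝒦, d, hd, hadm, hchart, hG𝒦, hfil, hver, hsupp⟩ :=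
    exists_pointCentre_away₀ hG M O hO e σ hact hσp (∏ j ∈ Finset.univ.erase (0 : Fin 2), ∏ l : ZMod p, (X 1 + C ((![(0 : k), a] : Fin 2 → k) 0 - (![(0 : k), a] : Fin 2 → k) j) + (l.val : MvPolynomial (Fin 4) k) * X 0)) hσh (c := 3) (by norm_num) (![0, 1, 2] : Fin 3 → Fin 4) (by decide) (![9, 2, 3] : Fin 3 → ℕ)
      (fun l => by fin_cases l <;> simp) hσJ (fun _ => 0) (fun _ => rfl) hu (hcl _) hZW
  exact ⟨(∏ j ∈ Finset.univ.erase (0 : Fin 2), ∏ l : ZMod p, (X 1 + C ((![(0 : k), a] : Fin 2 → k) 0 - (![(0 : k), a] : Fin 2 → k) j) + (l.val : MvPolynomial (Fin 4) k) * X 0)), rfl, hσh, 𝒜u, gr, eW, hfull, htame, hσW, hpin, 𝒦, d, hd, hadm, hchart, hG𝒦, hfil, hver, hsupp⟩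

set_option maxHeartbeats 4000000 in
/-- ★★ **R4c LEVEL 1 AT THE FAR TANGENCY POINT `Q = (a, c)`** (`2c = 3a²`, `c² = a³`, `a ≠ 0`): recentred chart `e_Q = γ ∘ e` (`γ : x₁ ↦ x₁ + a, x₂ ↦ x₂ + x₁ + c`),
conjugate `σ_Q` with rows `x₀ ↦ x₀, x₁ ↦ x₁ + x₀, x₂ ↦ x₂` (INVARIANT), `x₃ ↦ x₃ + T_Q`, `T_Q = x₂² + 2x₁x₂ + 2c·x₂ + (1 − 3a)x₁² − x₁³`, the `σ_Q`-fixed localising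
polynomial `hh_Q = N(x₁ + a)`, the node of `D(e_Q⁻¹hh_Q)` in the uniform trivial grading, and its admissible root `(x₀ : 3, y : 1, v : 2)` (✓QhRoot type, `sh = 2`:
✓`QhAway.qh_poly_map_le`) with centre chart, `G`-stability, filtration clause, `VeroneseNormalised`, support in the chart. [OURS · L1 W4.5c · R4c; NOT a statement of the manuscript] -/
theorem exists_cuspQ_pointCentre [Finite G] (hG : ∀ g : G, g ∈ Subgroup.zpowers g₀) (M : GModel p q G ρ g₀) [M.V.IsSeparated]
    (O : M.act.StableAffineOpens) (hO : IsAffineOpen O.1)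
    {k : Type} [Field k] [Fact p.Prime] [CharP k p] (e : Γ(M.V, O.1) ≃+* (MvPolynomial (Fin 4) k)) (σ : (MvPolynomial (Fin 4) k) ≃+* (MvPolynomial (Fin 4) k)) (hC : ∀ a : k, σ (C a) = C a)
    (h0 : σ (X 0) = X 0) (h1 : σ (X 1) = X 1 + X 0) (h2 : σ (X 2) = X 2 + X 0) (h3 : σ (X 3) = X 3 + (X 2 ^ 2 - X 1 ^ 3))
    (hact : ∀ t : Γ(M.V, O.1), actOEquiv M.act O g₀ t = e.symm (σ (e t))) (hσp : ∀ a : (MvPolynomial (Fin 4) k), (⇑σ)^[p] a = a)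
    (hcl : ∀ S : Set Γ(M.V, O.1), IsClosed (M.V.zeroLocus (U := O.1) S ∩ (O.1 : Set M.V))) (a c : k) (ha : a ≠ 0)
    (hQ1 : 2 * c = 3 * a ^ 2) (hQ2 : c ^ 2 = a ^ 3) :
    ∃ (hh : (MvPolynomial (Fin 4) k)) (_ : hh = (∏ j ∈ Finset.univ.erase (1 : Fin 2), ∏ l : ZMod p, (X 1 + C ((![(0 : k), a] : Fin 2 → k) 1 - (![(0 : k), a] : Fin 2 → k) j) + (l.val : MvPolynomial (Fin 4) k) * X 0))) (γ : (MvPolynomial (Fin 4) k) ≃ₐ[k] (MvPolynomial (Fin 4) k)) (eQ : Γ(M.V, O.1) ≃+* (MvPolynomial (Fin 4) k)) (σQ : (MvPolynomial (Fin 4) k) ≃+* (MvPolynomial (Fin 4) k)) (hσh : σQ hh = hh)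
      (hactQ : ∀ t : Γ(M.V, O.1), actOEquiv M.act O g₀ t = eQ.symm (σQ (eQ t))),
      (∀ t, eQ t = γ (e t)) ∧
      (γ (X 0) = X 0 ∧ γ (X 1) = X 1 + C a ∧ γ (X 2) = X 2 + X 1 + C c ∧ γ (X 3) = X 3 ∧
        γ.symm (X 0) = X 0 ∧ γ.symm (X 1) = X 1 - C a ∧ γ.symm (X 2) = X 2 - X 1 + C (a - c) ∧ γ.symm (X 3) = X 3) ∧
      ((∀ a : k, σQ (C a) = C a) ∧ σQ (X 0) = X 0 ∧ σQ (X 1) = X 1 + X 0 ∧ σQ (X 2) = X 2 ∧ σQ (X 3) = X 3 + (X 2 ^ 2 + 2 * X 1 * X 2 + C (2 * c) * X 2 + C (1 - 3 * a) * X 1 ^ 2 - X 1 ^ 3 : MvPolynomial (Fin 4) k) ∧ (∀ a : (MvPolynomial (Fin 4) k), (⇑σQ)^[p] a = a)) ∧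
      ∃ (𝒜u : (Π j : Fin 0, ZMod ((![] : Fin 0 → ℕ) j)) → AddSubgroup (Localization.Away hh)) (_ : GradedRing 𝒜u) (eW : Γ(M.V, (basicOpenStable M.act O hO (actO_symm_eq_of_fixed hG M O eQ σQ hactQ hh hσh)).1) ≃+* ↥(𝒜u 0)),
        (∀ (d : (Π j : Fin 0, ZMod ((![] : Fin 0 → ℕ) j))) (x : (Localization.Away hh)), x ∈ 𝒜u d) ∧
        IsTameNode p (Localization.Away hh) 𝒜u (sigmaAway σQ hσh) ∧
        (∀ t' : Γ(M.V, (basicOpenStable M.act O hO (actO_symm_eq_of_fixed hG M O eQ σQ hactQ hh hσh)).1), ((eW ((M.act.aut g₀⁻¹).hom.appLE (basicOpenStable M.act O hO (actO_symm_eq_of_fixed hG M O eQ σQ hactQ hh hσh)).1 (basicOpenStable M.act O hO (actO_symm_eq_of_fixed hG M O eQ σQ hactQ hh hσh)).1 ((basicOpenStable M.act O hO (actO_symm_eq_of_fixed hG M O eQ σQ hactQ hh hσh)).2.1 g₀⁻¹).ge t') : ↥(𝒜u 0)) : (Localization.Away hh)) = sigmaAway σQ hσh ((eW t' : ↥(𝒜u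 0)) : (Localization.Away hh))) ∧
        (∀ t : Γ(M.V, O.1), ((eW (algebraMap Γ(M.V, O.1) Γ(M.V, M.V.basicOpen (eQ.symm hh)) t) : ↥(𝒜u 0)) : (Localization.Away hh)) = algebraMap (MvPolynomial (Fin 4) k) (Localization.Away hh) (eQ t)) ∧
        ∃ (𝒦 : ReesFiltration M.V) (d : ℕ), 0 < d ∧ IsAdmissibleCentre p M.act g₀ 𝒦 d ∧ IsCentreChart p M.act g₀ 𝒦 d (basicOpenStable M.act O hO (actO_symm_eq_of_fixed hG M O eQ σQ hactQ hh hσh)) ∧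
          (∀ (g' : G) (n : ℕ), (𝒦.ideal n).comap (M.act.aut g').hom = 𝒦.ideal n) ∧
          (∀ n, (𝒦.filtration ⟨(basicOpenStable M.act O hO (actO_symm_eq_of_fixed hG M O eQ σQ hactQ hh hσh)).1, hO.basicOpen (eQ.symm hh)⟩).ideal n = ((traceFiltration 𝒜u (fun l => algebraMap (MvPolynomial (Fin 4) k) (Localization.Away hh) (X ((![0, 1, 2] : Fin 3 → Fin 4) l))) (![3, 1, 2] : Fin 3 → ℕ)).ideal n).comap (eW : Γ(M.V, (basicOpenStable M.act O hO (actO_symm_eq_of_fixed hG M O eQ σQ hactQ hh hσh)).1) →+* ↥(𝒜u 0))) ∧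
          VeroneseNormalised 𝒜u (fun l => algebraMap (MvPolynomial (Fin 4) k) (Localization.Away hh) (X ((![0, 1, 2] : Fin 3 → Fin 4) l))) (![3, 1, 2] : Fin 3 → ℕ) d ∧
          (((𝒦.ideal d).support : Set M.V)) ⊆ ((basicOpenStable M.act O hO (actO_symm_eq_of_fixed hG M O eQ σQ hactQ hh hσh)).1 : Set M.V) := by
  classical
  haveI : NeZero p := ⟨(Fact.out : p.Prime).ne_zero⟩
  have hα : Function.Injective (![(0 : k), a] : Fin 2 → k) := injective_zero_pair ha
  -- recentre
  obtain ⟨γ, σ', hσ', hγ0, hγ1, hγ2, hγ3, hγs0, hγs1, hγs2, hγs3, hC', h0', h1', h2', h3'⟩ :=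
    FreeModel.exists_cusp_recentre k σ hC h0 h1 h2 (X 2 ^ 2 - X 1 ^ 3) h3 a c
  have h3'' : σ' (X 3) = X 3 + (X 2 ^ 2 + 2 * X 1 * X 2 + C (2 * c) * X 2 + C (1 - 3 * a) * X 1 ^ 2 - X 1 ^ 3 : MvPolynomial (Fin 4) k) := by rw [h3', FreeModel.shear_cuspTail γ hγ1 hγ2 hQ1 hQ2]
  have hσp' : ∀ a : (MvPolynomial (Fin 4) k), (⇑σ')^[p] a = a := fun a => by
    rw [iterate_conj_eq γ.toEquiv σ σ' (fun x => hσ' x) p a]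
    change γ ((⇑σ)^[p] (γ.symm a)) = a
    rw [hσp, γ.apply_symm_apply]
  let eQ : Γ(M.V, O.1) ≃+* (MvPolynomial (Fin 4) k) := e.trans γ.toRingEquiv
  have heQ : ∀ t, eQ t = γ (e t) := fun _ => rfl
  have hactQ : ∀ t : Γ(M.V, O.1), actOEquiv M.act O g₀ t = eQ.symm (σ' (eQ t)) := fun t => by
    rw [hact t, hσ']
    change e.symm (σ (e t)) = e.symm (γ.symm (γ (σ (γ.symm (γ (e t))))))
    rw [γ.symm_apply_apply, γ.symm_apply_apply]
  have hσh : σ' (∏ j ∈ Finset.univ.erase (1 : Fin 2), ∏ l : ZMod p, (X 1 + C ((![(0 : k), a] : Fin 2 → k) 1 - (![(0 : k), a] : Fin 2 → k) j) + (l.val : MvPolynomial (Fin 4) k) * X 0)) = (∏ j ∈ Finset.univ.erase (1 : Fin 2), ∏ l : ZMod p, (X 1 + C ((![(0 : k), a] : Fin 2 → k) 1 - (![(0 : k), a] : Fin 2 → k) j) + (l.val : MvPolynomial (Fin 4) k) * X 0)) := GraphTail.sigma_locPoly σ' hC' h0' h1' (Finset.univ.erase 1) (fun j => (![(0 : k),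 a] : Fin 2 → k) 1 - (![(0 : k), a] : Fin 2 → k) j)
  -- the hypotheses of the point-centre producer
  have hw0 : (![3, 1, 2] : Fin 3 → ℕ) 0 = (![3, 1, 2] : Fin 3 → ℕ) 1 + 2 := by decide
  have hσJ : ∀ n : ℕ, ((weightedFiltration ((X : Fin 4 → (MvPolynomial (Fin 4) k)) ∘ (![0, 1, 2] : Fin 3 → Fin 4)) (![3, 1, 2] : Fin 3 → ℕ)).ideal n).map (σ' : (MvPolynomial (Fin 4) k) →+* (MvPolynomial (Fin 4) k)) ≤
      (weightedFiltration ((X : Fin 4 → (MvPolynomial (Fin 4) k)) ∘ (![0, 1, 2] : Fin 3 → Fin 4)) (![3, 1, 2] : Fin 3 → ℕ)).ideal n :=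
    fun n => QhAway.qh_poly_map_le σ' hC' h0' h1' h2' (X 2 ^ 2 + 2 * X 1 * X 2 + C (2 * c) * X 2 + C (1 - 3 * a) * X 1 ^ 2 - X 1 ^ 3 : MvPolynomial (Fin 4) k) h3'' (![3, 1, 2] : Fin 3 → ℕ) 2 hw0 (Cusp.cuspTailQ_mem a c) n
  have hne : ∀ j ∈ Finset.univ.erase (1 : Fin 2), (![(0 : k), a] : Fin 2 → k) 1 - (![(0 : k), a] : Fin 2 → k) j ≠ 0 := fun j hj h => Finset.ne_of_mem_erase hj (hα (sub_eq_zero.mp h)).symm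
  have hu : MvPolynomial.eval (fun _ : Fin 4 => (0 : k)) (∏ j ∈ Finset.univ.erase (1 : Fin 2), ∏ l : ZMod p, (X 1 + C ((![(0 : k), a] : Fin 2 → k) 1 - (![(0 : k), a] : Fin 2 → k) j) + (l.val : MvPolynomial (Fin 4) k) * X 0)) ≠ 0 := GraphTail.eval_locPoly_ne_zero (Finset.univ.erase 1) (fun j => (![(0 : k), a] : Fin 2 → k) 1 - (![(0 : k), a] : Fin 2 → k) j) hne _ rfl rfl
  have hcst : (∏ j ∈ Finset.univ.erase (1 : Fin 2), ((![(0 : k), a] : Fin 2 → k) 1 - (![(0 : k), a] : Fin 2 → k) j) ^ p) ≠ 0 := Finset.prod_ne_zero_iff.mpr fun j hj => pow_ne_zero _ (hne j hj)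
  have hZW := Scheme.zeroLocus_inter_subset_basicOpen_of_sub_C_mem_span (U := O.1) eQ (![0, 1, 2] : Fin 3 → Fin 4) (∏ j ∈ Finset.univ.erase (1 : Fin 2), ∏ l : ZMod p, (X 1 + C ((![(0 : k), a] : Fin 2 → k) 1 - (![(0 : k), a] : Fin 2 → k) j) + (l.val : MvPolynomial (Fin 4) k) * X 0)) _ hcst
    (GraphTail.locPoly_sub_C_mem_span (Finset.univ.erase 1) (fun j => (![(0 : k), a] : Fin 2 → k) 1 - (![(0 : k), a] : Fin 2 → k) j))
  obtain ⟨𝒜u, gr, eW, hfull, htame, hσW, hpin, 𝒦, d, hd, hadm, hchart, hG𝒦, hfil, hver, hsupp⟩ :=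
    exists_pointCentre_away₀ hG M O hO eQ σ' hactQ hσp' (∏ j ∈ Finset.univ.erase (1 : Fin 2), ∏ l : ZMod p, (X 1 + C ((![(0 : k), a] : Fin 2 → k) 1 - (![(0 : k), a] : Fin 2 → k) j) + (l.val : MvPolynomial (Fin 4) k) * X 0)) hσh (c := 3) (by norm_num) (![0, 1, 2] : Fin 3 → Fin 4) (by decide) (![3, 1, 2] : Fin 3 → ℕ)
      (fun l => by fin_cases l <;> simp) hσJ (fun _ => 0) (fun _ => rfl) hu (hcl _) hZW
  exact ⟨(∏ j ∈ Finset.univ.erase (1 : Fin 2), ∏ l : ZMod p, (X 1 + C ((![(0 : k), a] : Fin 2 → k) 1 - (![(0 : k), a] : Fin 2 → k) j) + (l.val : MvPolynomial (Fin 4) k) * X 0)), rfl, γ, eQ, σ', hσh, hactQ, heQ, ⟨hγ0, hγ1, hγ2, hγ3, hγs0, hγs1, hγs2, hγs3⟩, ⟨hC', h0', h1', h2', h3'', hσp'⟩,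
    𝒜u, gr, eW, hfull, htame, hσW, hpin, 𝒦, d, hd, hadm, hchart, hG𝒦, hfil, hver, hsupp⟩

end Summit.ResolutionOfSingularities.ResolutionOfSingularities.Theorems.WildQuotientResolution.S1.GameFrame.GModel

end
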